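import Summits.RiemannHypothesis.RiemannHypothesis.Theorems.LiAsymptoticLiBoxTwoSided
import Summits.RiemannHypothesis.RiemannHypothesis.Theorems.LiCoefficientsLiWindowIdentity
import Summits.RiemannHypothesis.RiemannHypothesis.Theorems.LiAsymptoticOscPlain
import Summits.RiemannHypothesis.RiemannHypothesis.Theorems.LiAsymptoticModelIntegral
import Literature.NumberTheory.LFunctions.EquivalentsKeiperLiProofs
import Literature.NumberTheory.LFunctions.TuringMethod
import HarnessLib
import Summits.RiemannHypothesis.RiemannHypothesis.Theorems.LiAsymptoticSmoothReplace
import Literature.NumberTheory.LFunctions.ZetaZeroWindowsExplicit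
import Mathlib.NumberTheory.Harmonic.Bounds
import Mathlib.Analysis.PSeries
import Summits.RiemannHypothesis.RiemannHypothesis.Theorems.Splittings.LiIncrBlockLaw

/-!
# RH-free LOW-ZERO BUDGET [γ] for T-Li3 — preliminaries (li-bridge g6 SketchG6B §§1–4)

Cell rh-split, seat rh-split-li-bridge g6 (brief sha16 f79c5f09d8bcb036), card `run/shared/lean/pub/rh-split/cards/SPLIT-li-bridge.md` §13
(13.5 paper proof «SOUND ON PAPER», referee rh-split-ref g3 06:17:36Z; 13.17); kernel source `HOME/rh-split-li-bridge/SketchG6T.lean` sha16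
911a043700f05677 (2287 l; = SketchG6B [γ] ++ SketchG6C [α][β] ++ Part D [δ] ++ Part T, re-pointed at the tree's `LiIncrMeanSquare` /
`LiIncrBlockLaw`, p508264 / p508611).  Filed by rh-split-typer-2 g4 (lane (xi)(c)–(f)) as a chain of ten tree modules cut at the scratch's
section boundaries, decl text byte-verbatim; deltas = namespaces `RhSplit.LiBridgeG6B/C/D/T` ↦
`…Theorems.Splittings.{LiLowZeroBudget, LiIncrHighPart, LiIncrBlockLawOfRH}` (qualified cross-references rewritten), module docstrings, and
one-line docstrings added where the scratch had none.  END-TO-END statement of the chain (last file):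
`LiIncrBlockLawOfRH.rh_iff_almostAllLiMonotone : RiemannHypothesis ↔ ∃ E ⊆ ℕ of natural density zero, ∀ n ≥ 1, n ∉ E → λ_n ≤ λ_{n+1}`
— T-Li3 IN KERNEL, a RELABELLING of RH (RH-EQUIVALENT, PROVED; certifies nothing about RH; class (li, bridge) unchanged).

This file: The resolving kernel is the TREE's `LiIncrMeanSquare.MeanSquare.dirichletBound`; §2 zeros (multiplicity, no zeros below height 14, window counts),
§3 splitting `zerosBetween` into unit windows, §4 elementary analysis (`log x ≤ 4x^{1/4}`, harmonic sums, the `p = 3/2` series).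

Gate dedup: `zerosBetween_split`, `log_le_four_mul_sqrt_sqrt`, `rpow_three_halves`, `log_nat_le_log`, `sum_inv_succ_le` are `private` here (they restate landed lemmas of other modules; private plumbing).

HONEST LABEL: «SPLITTING SEARCH over kernel-typed RH-EQUIVALENCES; a splitting A ∧ B ⟹ RH is CONDITIONAL bookkeeping unless A and B are
both proved; nothing here bears on the truth of RH.»
-/

set_option linter.dupNamespace false

noncomputable section

namespace Summit.RiemannHypothesis.RiemannHypothesis.Theorems.Splittings.LiLowZeroBudget

open Finset
open Literature.NumberTheory.LFunctions Literature.NumberTheory.LFunctions.SchoenfeldBound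
open Summit.RiemannHypothesis.RiemannHypothesis.Theorems.LiTheory
open Summit.RiemannHypothesis.RiemannHypothesis.Theorems.Splittings.LiIncrMeanSquare.MeanSquare

/-! ## §1 The resolving kernel `D_M(α) = π / max(|α|, π/M)` — the TREE's
`Splittings.LiIncrMeanSquare.MeanSquare.dirichletBound` (p508264; same body as `SketchG6` §4 and as the
former local def of `SketchG6B`), with its generic lemmas `dirichletBound_nonneg`, `dirichletBound_le_card`. -/

open Summit.RiemannHypothesis.RiemannHypothesis.Theorems.Splittings.LiIncrMeanSquare.MeanSquare
  (dirichletBound dirichletBound_nonneg dirichletBound_le_card)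

/-- Auxiliary lemma `dirichletBound_le_of_le_abs` of the low-zero budget [γ] preliminaries (li-bridge g6 `SketchG6T`; see the module docstring for its place in the argument). -/
theorem dirichletBound_le_of_le_abs {M : ℕ} {α b : ℝ} (hb : 0 < b) (hα : b ≤ |α|) :
    dirichletBound M α ≤ Real.pi / b := by
  unfold dirichletBound
  exact div_le_div_of_nonneg_left Real.pi_pos.le hb (hα.trans (le_max_left _ _))

/-! ## §2 Zeros: multiplicity, no zeros below height 14, window counts -/

/-- The multiplicity `m(ρ)` as a real number. -/
def mult (ρ : ℂ) : ℝ := (riemannZetaZeroOrder ρ : ℝ)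

/-- Auxiliary lemma `mem_zb` of the low-zero budget [γ] preliminaries (li-bridge g6 `SketchG6T`; see the module docstring for its place in the argument). -/
theorem mem_zb {a b : ℝ} (ha : 0 ≤ a) {ρ : ℂ} (h : ρ ∈ zerosBetween a b) :
    riemannZeta ρ = 0 ∧ 0 ≤ ρ.re ∧ ρ.re ≤ 1 ∧ a < ρ.im ∧ ρ.im ≤ b :=
  (mem_zerosBetween ha).1 h

/-- Auxiliary lemma `mult_nonneg` of the low-zero budget [γ] preliminaries (li-bridge g6 `SketchG6T`; see the module docstring for its place in the argument). -/
theorem mult_nonneg {a b : ℝ} (ha : 0 ≤ a) {ρ : ℂ} (h : ρ ∈ zerosBetween a b) : 0 ≤ mult ρ :=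
  zeroOrder_nonneg_of_mem_zerosBetween ha h

/-- Auxiliary lemma `one_le_mult` of the low-zero budget [γ] preliminaries (li-bridge g6 `SketchG6T`; see the module docstring for its place in the argument). -/
theorem one_le_mult {a b : ℝ} (ha : 0 ≤ a) {ρ : ℂ} (h : ρ ∈ zerosBetween a b) : 1 ≤ mult ρ := by
  have h1 := ZetaZeros.riemannZetaNontrivialZeros.one_le_order
    (mem_nontrivialZeros_of_mem_zerosBetween ha h)
  unfold mult
  exact_mod_cast h1

/-- Auxiliary lemma `sum_mult_eq` of the low-zero budget [γ] preliminaries (li-bridge g6 `SketchG6T`; see the module docstring for its place in the argument). -/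
theorem sum_mult_eq {a b : ℝ} (hab : a ≤ b) :
    ∑ ρ ∈ zerosBetween a b, mult ρ = (zetaZeroCount b : ℝ) - zetaZeroCount a := by
  unfold mult
  exact (zetaZeroCount_sub_eq_sum hab).symm

/-- Auxiliary lemma `zetaZeroCount_zero` of the low-zero budget [γ] preliminaries (li-bridge g6 `SketchG6T`; see the module docstring for its place in the argument). -/
theorem zetaZeroCount_zero : zetaZeroCount 0 = 0 :=
  Nat.le_zero.1 ((zetaZeroCount_mono (by norm_num : (0 : ℝ) ≤ 14)).trans_eq zetaZeroCount_fourteen)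

/-- Every zero in `zerosBetween 0 Y` has height `> 14` (`N(14) = 0`). -/
theorem fourteen_lt_im {Y : ℝ} {ρ : ℂ} (h : ρ ∈ zerosBetween 0 Y) : 14 < ρ.im := by
  by_contra hle
  rw [not_lt] at hle
  obtain ⟨hz, h1, h2, h3, -⟩ := mem_zb le_rfl h
  have hmem : ρ ∈ zerosBetween 0 14 := (mem_zerosBetween le_rfl).2 ⟨hz, h1, h2, h3, hle⟩
  have hsum : ∑ ρ' ∈ zerosBetween 0 14, mult ρ' = 0 := by
    rw [sum_mult_eq (by norm_num : (0 : ℝ) ≤ 14), zetaZeroCount_fourteen, zetaZeroCount_zero]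
    simp
  have hle1 : mult ρ ≤ ∑ ρ' ∈ zerosBetween 0 14, mult ρ' :=
    Finset.single_le_sum (fun ρ' h' ↦ mult_nonneg le_rfl h') hmem
  linarith [one_le_mult le_rfl h]

/-- Membership transport to a box from height `0`. -/
theorem mem_zb_zero {a b : ℝ} (ha : 0 ≤ a) {ρ : ℂ} (h : ρ ∈ zerosBetween a b) :
    ρ ∈ zerosBetween 0 b := by
  obtain ⟨hz, h1, h2, h3, h4⟩ := mem_zb ha h
  exact (mem_zerosBetween le_rfl).2 ⟨hz, h1, h2, ha.trans_lt h3, h4⟩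

/-- One window: `Σ_{u < γ ≤ u+1} m ≤ 3 log(u+2)` (`u ≥ 0`). -/
theorem sum_mult_window_le {u : ℝ} (hu : 0 ≤ u) :
    ∑ ρ ∈ zerosBetween u (u + 1), mult ρ ≤ 3 * Real.log (u + 2) := by
  rw [sum_mult_eq (by linarith)]
  have h := zetaZeroCount_window_le_three_log u
  rwa [abs_of_nonneg hu] at h

/-- Two windows: `Σ_{γ−1 < γ' ≤ γ+1} m ≤ 6 log(γ+2)` (`γ ≥ 1`). -/
theorem sum_mult_two_windows_le {γ : ℝ} (hγ : 1 ≤ γ) :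
    ∑ ρ ∈ zerosBetween (γ - 1) (γ + 1), mult ρ ≤ 6 * Real.log (γ + 2) := by
  rw [sum_mult_eq (by linarith)]
  have h1 := zetaZeroCount_window_le_three_log γ
  have h2 := zetaZeroCount_window_le_three_log (γ - 1)
  rw [abs_of_nonneg (by linarith : (0 : ℝ) ≤ γ)] at h1
  rw [abs_of_nonneg (by linarith : (0 : ℝ) ≤ γ - 1)] at h2
  have h12 : γ - 1 + 1 = γ := by ring
  rw [h12] at h2
  have h3 : Real.log (γ - 1 + 2) ≤ Real.log (γ + 2) := Real.log_le_log (by linarith) (by linarith)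
  linarith

/-- Window facts for `ρ ∈ zerosBetween k (k+1)`, `k : ℕ`. -/
theorem mem_window {k : ℕ} {ρ : ℂ} (h : ρ ∈ zerosBetween (k : ℝ) (k + 1)) :
    (k : ℝ) < ρ.im ∧ ρ.im ≤ k + 1 ∧ 14 < ρ.im ∧ (13 : ℝ) < k ∧ 0 ≤ mult ρ := by
  obtain ⟨-, -, -, h3, h4⟩ := mem_zb (Nat.cast_nonneg k) h
  have h14 := fourteen_lt_im (mem_zb_zero (Nat.cast_nonneg k) h)
  exact ⟨h3, h4, h14, by linarith, mult_nonneg (Nat.cast_nonneg k) h⟩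

/-- Auxiliary lemma `sum_mult_window_nat` of the low-zero budget [γ] preliminaries (li-bridge g6 `SketchG6T`; see the module docstring for its place in the argument). -/
theorem sum_mult_window_nat (k : ℕ) :
    ∑ ρ ∈ zerosBetween (k : ℝ) (k + 1), mult ρ ≤ 3 * Real.log ((k : ℝ) + 2) :=
  sum_mult_window_le (Nat.cast_nonneg k)

/-- Auxiliary lemma `sum_mult_window_nat_nonneg` of the low-zero budget [γ] preliminaries (li-bridge g6 `SketchG6T`; see the module docstring for its place in the argument). -/
theorem sum_mult_window_nat_nonneg (k : ℕ) :
    0 ≤ ∑ ρ ∈ zerosBetween (k : ℝ) (k + 1), mult ρ :=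
  Finset.sum_nonneg fun _ h ↦ mult_nonneg (Nat.cast_nonneg k) h

/-! ## §3 Splitting `zerosBetween` into unit windows -/

/-- Auxiliary lemma `zerosBetween_split` of the low-zero budget [γ] preliminaries (li-bridge g6 `SketchG6T`; see the module docstring for its place in the argument). -/
private theorem zerosBetween_split {a b c : ℝ} (ha : 0 ≤ a) (hab : a ≤ b) (hbc : b ≤ c) :
    zerosBetween a c = zerosBetween a b ∪ zerosBetween b c ∧
      Disjoint (zerosBetween a b) (zerosBetween b c) := by
  have hb : 0 ≤ b := ha.trans hab
  constructor
  · ext ρ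
    rw [Finset.mem_union, mem_zerosBetween ha, mem_zerosBetween ha, mem_zerosBetween hb]
    constructor
    · rintro ⟨hz, h1, h2, h3, h4⟩
      rcases le_or_gt ρ.im b with h | h
      · exact Or.inl ⟨hz, h1, h2, h3, h⟩
      · exact Or.inr ⟨hz, h1, h2, h, h4⟩
    · rintro (⟨hz, h1, h2, h3, h4⟩ | ⟨hz, h1, h2, h3, h4⟩)
      · exact ⟨hz, h1, h2, h3, h4.trans hbc⟩
      · exact ⟨hz, h1, h2, hab.trans_lt h3, h4⟩
  · rw [Finset.disjoint_left]
    intro ρ hρ hρ'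
    obtain ⟨-, -, -, -, h4⟩ := (mem_zerosBetween ha).1 hρ
    obtain ⟨-, -, -, h3, -⟩ := (mem_zerosBetween hb).1 hρ'
    exact absurd h4 (not_le.2 h3)

/-- Auxiliary lemma `zerosBetween_zero_zero` of the low-zero budget [γ] preliminaries (li-bridge g6 `SketchG6T`; see the module docstring for its place in the argument). -/
theorem zerosBetween_zero_zero : zerosBetween 0 0 = ∅ := by
  ext ρ
  simp only [Finset.notMem_empty, iff_false]
  intro h
  obtain ⟨-, -, -, h3, h4⟩ := (mem_zerosBetween le_rfl).1 h
  exact absurd h4 (not_le.2 h3)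

/-- `Σ_{0 < γ ≤ M} F = Σ_{k < M} Σ_{k < γ ≤ k+1} F`. -/
theorem sum_zerosBetween_nat (F : ℂ → ℝ) (M : ℕ) :
    ∑ ρ ∈ zerosBetween 0 (M : ℝ), F ρ = ∑ k ∈ range M, ∑ ρ ∈ zerosBetween (k : ℝ) (k + 1), F ρ := by
  induction M with
  | zero => simp [zerosBetween_zero_zero]
  | succ M ih =>
      obtain ⟨hU, hD⟩ := zerosBetween_split (a := 0) (b := (M : ℝ)) (c := (M : ℝ) + 1) le_rfl
        (Nat.cast_nonneg M) (by linarith)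
      rw [Finset.sum_range_succ, ← ih, Nat.cast_succ, hU, Finset.sum_union hD]

/-- Monotone comparison: for `F ≥ 0` on zeros, `Σ_{0<γ≤Y} F ≤ Σ_{k<⌈Y⌉} Σ_{window k} F`. -/
theorem sum_le_windows {Y : ℝ} {F : ℂ → ℝ} (hF : ∀ b ρ, ρ ∈ zerosBetween 0 b → 0 ≤ F ρ) :
    ∑ ρ ∈ zerosBetween 0 Y, F ρ ≤ ∑ k ∈ range ⌈Y⌉₊, ∑ ρ ∈ zerosBetween (k : ℝ) (k + 1), F ρ := by
  rw [← sum_zerosBetween_nat]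
  apply Finset.sum_le_sum_of_subset_of_nonneg
  · intro ρ hρ
    obtain ⟨hz, h1, h2, h3, h4⟩ := mem_zb le_rfl hρ
    exact (mem_zerosBetween le_rfl).2 ⟨hz, h1, h2, h3, h4.trans (Nat.le_ceil Y)⟩
  · intro ρ hρ _
    exact hF _ ρ hρ

/-! ## §4 Elementary analysis: `log x ≤ 4 x^{1/4}`, harmonic sums, the `p = 3/2` series -/

/-- Auxiliary lemma `log_le_four_mul_sqrt_sqrt` of the low-zero budget [γ] preliminaries (li-bridge g6 `SketchG6T`; see the module docstring for its place in the argument). -/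
private theorem log_le_four_mul_sqrt_sqrt {x : ℝ} (hx : 0 < x) : Real.log x ≤ 4 * Real.sqrt (Real.sqrt x) := by
  have h1 : Real.log x = 4 * Real.log (Real.sqrt (Real.sqrt x)) := by
    rw [Real.log_sqrt (Real.sqrt_nonneg _), Real.log_sqrt hx.le]; ring
  have hpos : 0 < Real.sqrt (Real.sqrt x) := Real.sqrt_pos.2 (Real.sqrt_pos.2 hx)
  have h2 := Real.log_le_sub_one_of_pos hpos
  linarith

/-- `log(x+3)² ≤ 32 √x` for `x ≥ 1`. -/
theorem log_sq_le {x : ℝ} (hx : 1 ≤ x) : Real.log (x + 3) ^ 2 ≤ 32 * Real.sqrt x := by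
  have h0 : 0 ≤ Real.log (x + 3) := Real.log_nonneg (by linarith)
  have h1 := log_le_four_mul_sqrt_sqrt (by linarith : 0 < x + 3)
  have h2 : Real.log (x + 3) ^ 2 ≤ (4 * Real.sqrt (Real.sqrt (x + 3))) ^ 2 :=
    pow_le_pow_left₀ h0 h1 2
  have h3 : (4 * Real.sqrt (Real.sqrt (x + 3))) ^ 2 = 16 * Real.sqrt (x + 3) := by
    rw [mul_pow, Real.sq_sqrt (Real.sqrt_nonneg _)]; norm_num
  have h4 : Real.sqrt (x + 3) ≤ Real.sqrt (4 * x) := Real.sqrt_le_sqrt (by linarith)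
  have h5 : Real.sqrt (4 * x) = 2 * Real.sqrt x := by
    rw [Real.sqrt_mul (by norm_num : (0 : ℝ) ≤ 4), show (4 : ℝ) = 2 ^ 2 by norm_num,
      Real.sqrt_sq (by norm_num : (0 : ℝ) ≤ 2)]
  linarith

/-- `(1 + log(x+2))³ ≤ 125 (x+2)` for `x ≥ 0`. -/
theorem one_add_log_cube_le {x : ℝ} (hx : 0 ≤ x) :
    (1 + Real.log (x + 2)) ^ 3 ≤ 125 * (x + 2) := by
  set u := Real.sqrt (Real.sqrt (x + 2)) with hu
  have hu1 : 1 ≤ u := by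
    rw [hu, Real.one_le_sqrt, Real.one_le_sqrt]; linarith
  have hL := log_le_four_mul_sqrt_sqrt (by linarith : 0 < x + 2)
  have hL0 : 0 ≤ Real.log (x + 2) := Real.log_nonneg (by linarith)
  have h1 : 1 + Real.log (x + 2) ≤ 5 * u := by rw [hu]; linarith
  have h2 : (1 + Real.log (x + 2)) ^ 3 ≤ (5 * u) ^ 3 := pow_le_pow_left₀ (by linarith) h1 3
  have hu4 : u ^ 4 = x + 2 := by
    rw [hu, show (4 : ℕ) = 2 * 2 by norm_num, pow_mul, Real.sq_sqrt (Real.sqrt_nonneg _),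
      Real.sq_sqrt (by linarith)]
  have h3 : u ^ 3 ≤ u ^ 4 := pow_le_pow_right₀ hu1 (by norm_num)
  nlinarith

/-- Auxiliary lemma `rpow_three_halves` of the low-zero budget [γ] preliminaries (li-bridge g6 `SketchG6T`; see the module docstring for its place in the argument). -/
private theorem rpow_three_halves {x : ℝ} (hx : 0 < x) : x ^ (3 / 2 : ℝ) = x * Real.sqrt x := by
  rw [show (3 / 2 : ℝ) = 1 + 1 / 2 by norm_num, Real.rpow_add hx, Real.rpow_one, Real.sqrt_eq_rpow]

/-- The convergent majorant: `3 log(k+3)²/k² ≤ 96 / k^{3/2}`. -/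
theorem near_majorant (k : ℕ) :
    3 * Real.log ((k : ℝ) + 3) ^ 2 / (k : ℝ) ^ 2 ≤ 96 * (1 / (k : ℝ) ^ (3 / 2 : ℝ)) := by
  rcases Nat.eq_zero_or_pos k with hk | hk
  · subst hk; simp
  have hk1 : (1 : ℝ) ≤ k := by exact_mod_cast hk
  have hk0 : (0 : ℝ) < k := by linarith
  have hs : Real.sqrt k * Real.sqrt k = k := Real.mul_self_sqrt hk0.le
  have hs0 : 0 < Real.sqrt (k : ℝ) := Real.sqrt_pos.2 hk0
  have hlog := log_sq_le hk1
  rw [rpow_three_halves hk0]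
  rw [div_le_iff₀ (by positivity)]
  have : 96 * (1 / ((k : ℝ) * Real.sqrt k)) * (k : ℝ) ^ 2 = 96 * Real.sqrt k := by
    field_simp
    nlinarith [hs]
  rw [this]
  linarith

/-- Auxiliary lemma `summable_majorant` of the low-zero budget [γ] preliminaries (li-bridge g6 `SketchG6T`; see the module docstring for its place in the argument). -/
theorem summable_majorant : Summable fun k : ℕ ↦ 96 * (1 / (k : ℝ) ^ (3 / 2 : ℝ)) :=
  (Real.summable_one_div_nat_rpow.mpr (by norm_num : (1 : ℝ) < 3 / 2)).mul_left 96

/-- The near-series constant `P := Σ' 96/k^{3/2}`. -/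
def nearConst : ℝ := ∑' k : ℕ, 96 * (1 / (k : ℝ) ^ (3 / 2 : ℝ))

/-- Auxiliary lemma `nearConst_nonneg` of the low-zero budget [γ] preliminaries (li-bridge g6 `SketchG6T`; see the module docstring for its place in the argument). -/
theorem nearConst_nonneg : 0 ≤ nearConst :=
  tsum_nonneg fun k ↦ by positivity

/-- Auxiliary lemma `sum_majorant_le` of the low-zero budget [γ] preliminaries (li-bridge g6 `SketchG6T`; see the module docstring for its place in the argument). -/
theorem sum_majorant_le (M : ℕ) :
    ∑ k ∈ range M, 96 * (1 / (k : ℝ) ^ (3 / 2 : ℝ)) ≤ nearConst :=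
  summable_majorant.sum_le_tsum (range M) fun k _ ↦ by positivity

/-- `Σ_{i<M} 1/(i+1) ≤ 1 + log M` (Mathlib's `harmonic_le_one_add_log`). -/
private theorem sum_inv_succ_le (M : ℕ) : ∑ i ∈ range M, 1 / ((i : ℝ) + 1) ≤ 1 + Real.log M := by
  have h := harmonic_le_one_add_log M
  have e : ((harmonic M : ℚ) : ℝ) = ∑ i ∈ range M, 1 / ((i : ℝ) + 1) := by
    simp [harmonic, one_div]
  linarith [e ▸ h]

/-- Auxiliary lemma `log_nat_le_log` of the low-zero budget [γ] preliminaries (li-bridge g6 `SketchG6T`; see the module docstring for its place in the argument). -/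
private theorem log_nat_le_log {a b : ℕ} (h : a ≤ b) : Real.log a ≤ Real.log b := by
  rcases Nat.eq_zero_or_pos a with ha | ha
  · subst ha; simp only [Nat.cast_zero, Real.log_zero]; exact Real.log_natCast_nonneg b
  · exact Real.log_le_log (by exact_mod_cast ha) (by exact_mod_cast h)

/-- `Σ_{i<M} 1/i ≤ 2(1 + log M)` (with `1/0 = 0`). -/
theorem sum_inv_le (M : ℕ) : ∑ i ∈ range M, 1 / (i : ℝ) ≤ 2 * (1 + Real.log M) := by
  have h1 : ∑ i ∈ range M, 1 / (i : ℝ) ≤ ∑ i ∈ range M, 2 * (1 / ((i : ℝ) + 1)) := by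
    apply Finset.sum_le_sum
    intro i _
    rcases Nat.eq_zero_or_pos i with hi | hi
    · subst hi; norm_num
    · have hi1 : (1 : ℝ) ≤ i := by exact_mod_cast hi
      rw [div_le_iff₀ (by linarith), show 2 * (1 / ((i : ℝ) + 1)) * i = 2 * i / (i + 1) by ring,
        le_div_iff₀ (by linarith)]
      linarith
  rw [← Finset.mul_sum] at h1
  linarith [sum_inv_succ_le M]

/-- Row sums of `1/|k − k'|`: `Σ_{k'<M} 1/|k−k'| ≤ 3(1 + log M)` for `k < M`. -/
theorem sum_inv_abs_sub_le {k M : ℕ} (hk : k < M) :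
    ∑ k' ∈ range M, 1 / |(k : ℝ) - k'| ≤ 3 * (1 + Real.log M) := by
  have hsplit := Finset.sum_Ico_consecutive (fun k' : ℕ ↦ 1 / |(k : ℝ) - k'|) (Nat.zero_le k) hk.le
  rw [← Finset.range_eq_Ico] at hsplit
  rw [Finset.range_eq_Ico, ← hsplit]
  -- part 1: `k' < k`, reflect onto the harmonic sum
  have hp1 : ∑ k' ∈ range k, 1 / |(k : ℝ) - k'| = ∑ j ∈ range k, 1 / ((j : ℝ) + 1) := by
    rw [← Finset.sum_range_reflect (fun j : ℕ ↦ 1 / ((j : ℝ) + 1)) k]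
    apply Finset.sum_congr rfl
    intro j hj
    rw [Finset.mem_range] at hj
    have hc : ((k - 1 - j : ℕ) : ℝ) = (k : ℝ) - 1 - j := by
      rw [Nat.cast_sub (by omega), Nat.cast_sub (by omega)]; simp
    rw [hc, abs_of_pos (by
      have : (j : ℝ) + 1 ≤ k := by exact_mod_cast hj
      linarith)]
    ring
  -- part 2: `k ≤ k' < M`, shift
  have hp2 : ∑ k' ∈ Ico k M, 1 / |(k : ℝ) - k'| = ∑ j ∈ range (M - k), 1 / (j : ℝ) := by
    rw [Finset.sum_Ico_eq_sum_range]
    apply Finset.sum_congr rfl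
    intro j _
    rw [Nat.cast_add, show (k : ℝ) - (k + j) = -j by ring, abs_neg,
      abs_of_nonneg (Nat.cast_nonneg j)]
  rw [hp1, hp2]
  have h1 := sum_inv_succ_le k
  have h2 := sum_inv_le (M - k)
  have h3 : Real.log k ≤ Real.log M := log_nat_le_log hk.le
  have h4 : Real.log ((M - k : ℕ) : ℝ) ≤ Real.log M := log_nat_le_log (Nat.sub_le M k)
  linarith

end Summit.RiemannHypothesis.RiemannHypothesis.Theorems.Splittings.LiLowZeroBudget

end
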